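import Mathlib
import Summits.NavierStokesRegularity.FluidComputer.AbcInertiaEigenvalues
import Summits.NavierStokesRegularity.FluidComputer.AbcInertiaTranscript

/-!
# INERTIA-3L instantiation, Part 7: the CLASS-II CELLS OF RECORD as kernel implications —
# `(R, a, m) = (300, 1/5, 1)` at `(r_L, r_H) = (28, 29)` [i4] and `(28, 30)` [i3], `(500, 6/25, 1)` at `(36, 37)` [i4]
# (instab3 g8, cell `ns-blowup`, 2026-08-27)

HONEST FRAMING (human rulings D-0035/D-0074): **MODEL linear operator, computer-assisted; not NS.** Nothing
here is a statement about Navier–Stokes regularity or blow-up. Object: the linearisation of forced NS about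
`U = abcFlow 1 1 1` (`f = νU`, `ν = 1/(2πR)` on the unit torus = `1/R` in certifier units), symmetry class II.
bears_on LADDER-NS N1* T6 / profile W3 («is λ*_II the rightmost class-II eigenvalue; simple; gap»).

For each INERTIA-3L cell of record (`HOME/instab3/PREREG-INERTIA-3L.md`, INSTAB3-METHOD §14.5: impl-1 = i3,
cert `cert_I3L_R300_cII_a1-5_rL28_rH30.json` 42d246b366f59d1b, kit j269623; `HOME/instab4/inertia/INERTIA-I4.md`
§8: impl-2 = i4, `inertia_cert_R300_cII_rL28_rH29.json`, kit j269943; R 500 i4 cell `(36, 37)`, kit j269944)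
this file states the END-TO-END KERNEL IMPLICATION with the cell's numbers `R, a, m, r_L, r_H` as literals:
the two script-certified matrix facts
  (R1) `x ⬝ ((GH Â + Âᵀ GH + ½ F₂ diag(E)⁻¹ F₂ᵀ) x) < 0` for all real `x ≠ 0` on `H = {|O|² ≤ r_H²}`,
  (R2) `x ⬝ ((GH + V Vᵀ) x) ≥ 0` on `H` for a real `H × 1` matrix `V`,
about the symmetric head weight `GH` (`= X ⊕ 1`, `X` the weight of the certificate file) and the kernel's own
matrices `Â = [(−|O|²/R − a)δ + amat]_{HH}`, `F₂ = GH·amat_{HB} + amat_{BH}ᵀ` (block form for `X ⊕ 1`: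
`AbcInertiaCount.F2_apply_of_blockWeight`), `E_l = |O_l|²/R + a − √2`, IMPLY: the linearisation has AT MOST
ONE classical eigenvalue `z` (pairwise-distinct count `n ≤ 1`) with class-II eigenfunction and `Re z ≥ a`.
(R3) `√2 < (⌊r_H²⌋ + 1)/R + a` and (R4) are discharged here / in `AbcInertiaIndexSets`; the basis is instab4's
existential `bfam` (the certifiers' own bases need the AUDIT-BASIS clause of KERNEL-CHAIN §6, as for X0).
With the enclosure `CertificateAbcSpectrum.Row3002` (`AbcInertiaTranscript.R300II.a_lt_leader_4`: the certified
real class-II leader `λ* ≈ 0.2617` lies right of `a = 1/5`) the R 300 cell reads: `λ*_II(300)` is the ONLY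
class-II eigenvalue with `Re ≥ 1/5` — rightmost, simple (also algebraically: `AbcInertiaEigenvalues.
no_jordan_chain_of_count_one`), spectral gap `≥ λ* − 1/5 ≥ 0.0617`. What is NOT kernel-checked: (R1), (R2)
themselves — the programs' verified arithmetic (i3: Arb balls; i4: float64 + a-priori bounds), referee re-run
per TURNKEY-I3L.md / INERTIA-I4 §7.

Mathlib + `AbcInertiaEigenvalues` + `AbcInertiaTranscript`; no new definitions; std axioms. [folklore]
-/

noncomputable section

open scoped BigOperators ComplexConjugate Matrix
open Finset Matrix MeasureTheory UnitAddTorus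

namespace Summit.NavierStokesRegularity.FluidComputer.AbcInertia

open Literature.Analysis.FunctionSpaces Literature.Analysis.FunctionSpaces.Torus
open Literature.Analysis.FluidPDE
open Summit.NavierStokesRegularity.FluidComputer.AbcClassII

/-! ### §1 Arithmetic of the cells: (R3) and the transcript constants -/

/-- (R3) for `R = 300`, `a = 1/5`, `r_H = 29` (i4 cell): `√2 < 842/300 + 1/5`. -/
theorem R3_300_29 : Real.sqrt 2 < ((⌊(29 : ℝ) ^ 2⌋₊ : ℝ) + 1) / 300 + 1 / 5 := by
  rw [show ((29 : ℝ)) ^ 2 = ((841 : ℕ) : ℝ) by norm_num, Nat.floor_natCast]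
  rw [Real.sqrt_lt' (by norm_num)]; norm_num

/-- (R3) for `R = 300`, `a = 1/5`, `r_H = 30` (i3 cell): `√2 < 901/300 + 1/5`. -/
theorem R3_300_30 : Real.sqrt 2 < ((⌊(30 : ℝ) ^ 2⌋₊ : ℝ) + 1) / 300 + 1 / 5 := by
  rw [show ((30 : ℝ)) ^ 2 = ((900 : ℕ) : ℝ) by norm_num, Nat.floor_natCast]
  rw [Real.sqrt_lt' (by norm_num)]; norm_num

/-- (R3) for `R = 500`, `a = 6/25`, `r_H = 37` (i4 cell): `√2 < 1370/500 + 6/25`. -/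
theorem R3_500_37 : Real.sqrt 2 < ((⌊(37 : ℝ) ^ 2⌋₊ : ℝ) + 1) / 500 + 6 / 25 := by
  rw [show ((37 : ℝ)) ^ 2 = ((1369 : ℕ) : ℝ) by norm_num, Nat.floor_natCast]
  rw [Real.sqrt_lt' (by norm_num)]; norm_num

/-- The transcript's cell constants (`AbcInertiaTranscript.R300II`) are the literals used below. -/
theorem R300II_consts : (AbcInertiaTranscript.R300II.R : ℝ) = 300 ∧ ((AbcInertiaTranscript.R300II.a : ℚ) : ℝ) = 1 / 5 ∧
    AbcInertiaTranscript.R300II.m = 1 ∧ AbcInertiaTranscript.R300II.rL4 = 28 ∧ AbcInertiaTranscript.R300II.rH4 = 29 := by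
  refine ⟨by norm_num [AbcInertiaTranscript.R300II.R], by norm_num [AbcInertiaTranscript.R300II.a], rfl, rfl, rfl⟩

/-! ### §2 The cells -/

/-- **CELL (300, II, a = 1/5, m = 1) at (r_L, r_H) = (28, 29)** [implementation i4, kit j269943]: (R1) + (R2) ⇒ at
most ONE classical class-II eigenvalue with `Re z ≥ 1/5` of the linearisation about `abcFlow 1 1 1` at
viscosity `1/(2π·300)`. -/
theorem R300II_rL28_rH29_card_le_one {HL HH HB : Finset Idx}
    (hHL : ∀ i : Idx, i ∈ HL ↔ onormSq i.1 ≤ (28 : ℝ) ^ 2)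
    (hHH : ∀ i : Idx, i ∈ HH ↔ onormSq i.1 ≤ (29 : ℝ) ^ 2)
    (hHB : ∀ i : Idx, i ∈ HB ↔ (29 : ℝ) ^ 2 < onormSq i.1 ∧ onormSq i.1 ≤ ((29 : ℝ) + 1) ^ 2)
    (GH Ah : Matrix ↥HH ↥HH ℝ) (AHB : Matrix ↥HH ↥HB ℝ) (ABH : Matrix ↥HB ↥HH ℝ) (E : ↥HB → ℝ)
    (V : Matrix ↥HH (Fin 1) ℝ) (hGH : GHᵀ = GH)
    (hAh : Ah = Matrix.of fun i j : ↥HH =>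
      (if i = j then -(onormSq i.1.1 / (300 : ℝ)) - (1 / 5 : ℝ) else 0) + amat i.1 j.1)
    (hAHB : AHB = Matrix.of fun (i : ↥HH) (l : ↥HB) => amat i.1 l.1)
    (hABH : ABH = Matrix.of fun (l : ↥HB) (i : ↥HH) => amat l.1 i.1)
    (hE : E = fun l : ↥HB => onormSq l.1.1 / (300 : ℝ) + (1 / 5 : ℝ) - Real.sqrt 2)
    (hR1 : ∀ x : ↥HH → ℝ, x ≠ 0 →
      x ⬝ᵥ ((GH * Ah + Ahᵀ * GH + (1 / 2 : ℝ) • ((GH * AHB + ABHᵀ) * Matrix.diagonal (fun l => (E l)⁻¹) *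
        (GH * AHB + ABHᵀ)ᵀ)) *ᵥ x) < 0)
    (hR2 : ∀ x : ↥HH → ℝ, 0 ≤ x ⬝ᵥ ((GH + V * Vᵀ) *ᵥ x))
    {n : ℕ} (z : Fin n → ℂ) (hz : Function.Injective z)
    (u : Fin n → UnitAddTorus (Fin 3) → EuclideanSpace ℂ (Fin 3))
    (hu : ∀ k, Torus.LinNSResolventRel (1 / (2 * Real.pi * (300 : ℝ))) (Torus.abcFlow 1 1 1)
      (2 * Real.pi * z k) (u k) 0)
    (hu0 : ∀ k, u k ≠ 0) (hII : ∀ k, IsClassII (mFourierCoeff (u k))) (hre : ∀ k, (1 / 5 : ℝ) ≤ (z k).re) :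
    n ≤ 1 :=
  card_classII_eigenfunctions_le_of_inertia_certificate (R := 300) (a := 1 / 5) (rL := 28) (rH := 29)
    (by norm_num) (by norm_num) (by norm_num) hHL hHH hHB GH Ah AHB ABH E V hGH hAh hAHB hABH hE hR1 hR2
    R3_300_29 z hz u hu hu0 hII hre

/-- **CELL (300, II, a = 1/5, m = 1) at (r_L, r_H) = (28, 30)** [implementation i3, kit j269623, certificate
`cert_I3L_R300_cII_a1-5_rL28_rH30.json` 42d246b366f59d1b]: (R1) + (R2) ⇒ at most ONE classical class-II
eigenvalue with `Re z ≥ 1/5`. -/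
theorem R300II_rL28_rH30_card_le_one {HL HH HB : Finset Idx}
    (hHL : ∀ i : Idx, i ∈ HL ↔ onormSq i.1 ≤ (28 : ℝ) ^ 2)
    (hHH : ∀ i : Idx, i ∈ HH ↔ onormSq i.1 ≤ (30 : ℝ) ^ 2)
    (hHB : ∀ i : Idx, i ∈ HB ↔ (30 : ℝ) ^ 2 < onormSq i.1 ∧ onormSq i.1 ≤ ((30 : ℝ) + 1) ^ 2)
    (GH Ah : Matrix ↥HH ↥HH ℝ) (AHB : Matrix ↥HH ↥HB ℝ) (ABH : Matrix ↥HB ↥HH ℝ) (E : ↥HB → ℝ)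
    (V : Matrix ↥HH (Fin 1) ℝ) (hGH : GHᵀ = GH)
    (hAh : Ah = Matrix.of fun i j : ↥HH =>
      (if i = j then -(onormSq i.1.1 / (300 : ℝ)) - (1 / 5 : ℝ) else 0) + amat i.1 j.1)
    (hAHB : AHB = Matrix.of fun (i : ↥HH) (l : ↥HB) => amat i.1 l.1)
    (hABH : ABH = Matrix.of fun (l : ↥HB) (i : ↥HH) => amat l.1 i.1)
    (hE : E = fun l : ↥HB => onormSq l.1.1 / (300 : ℝ) + (1 / 5 : ℝ) - Real.sqrt 2)
    (hR1 : ∀ x : ↥HH → ℝ, x ≠ 0 →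
      x ⬝ᵥ ((GH * Ah + Ahᵀ * GH + (1 / 2 : ℝ) • ((GH * AHB + ABHᵀ) * Matrix.diagonal (fun l => (E l)⁻¹) *
        (GH * AHB + ABHᵀ)ᵀ)) *ᵥ x) < 0)
    (hR2 : ∀ x : ↥HH → ℝ, 0 ≤ x ⬝ᵥ ((GH + V * Vᵀ) *ᵥ x))
    {n : ℕ} (z : Fin n → ℂ) (hz : Function.Injective z)
    (u : Fin n → UnitAddTorus (Fin 3) → EuclideanSpace ℂ (Fin 3))
    (hu : ∀ k, Torus.LinNSResolventRel (1 / (2 * Real.pi * (300 : ℝ))) (Torus.abcFlow 1 1 1)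
      (2 * Real.pi * z k) (u k) 0)
    (hu0 : ∀ k, u k ≠ 0) (hII : ∀ k, IsClassII (mFourierCoeff (u k))) (hre : ∀ k, (1 / 5 : ℝ) ≤ (z k).re) :
    n ≤ 1 :=
  card_classII_eigenfunctions_le_of_inertia_certificate (R := 300) (a := 1 / 5) (rL := 28) (rH := 30)
    (by norm_num) (by norm_num) (by norm_num) hHL hHH hHB GH Ah AHB ABH E V hGH hAh hAHB hABH hE hR1 hR2
    R3_300_30 z hz u hu hu0 hII hre

/-- **CELL (500, II, a = 6/25, m = 1) at (r_L, r_H) = (36, 37)** [implementation i4, kit j269944]: (R1) + (R2) ⇒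
at most ONE classical class-II eigenvalue with `Re z ≥ 6/25` of the linearisation at viscosity `1/(2π·500)`. -/
theorem R500II_rL36_rH37_card_le_one {HL HH HB : Finset Idx}
    (hHL : ∀ i : Idx, i ∈ HL ↔ onormSq i.1 ≤ (36 : ℝ) ^ 2)
    (hHH : ∀ i : Idx, i ∈ HH ↔ onormSq i.1 ≤ (37 : ℝ) ^ 2)
    (hHB : ∀ i : Idx, i ∈ HB ↔ (37 : ℝ) ^ 2 < onormSq i.1 ∧ onormSq i.1 ≤ ((37 : ℝ) + 1) ^ 2)
    (GH Ah : Matrix ↥HH ↥HH ℝ) (AHB : Matrix ↥HH ↥HB ℝ) (ABH : Matrix ↥HB ↥HH ℝ) (E : ↥HB → ℝ)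
    (V : Matrix ↥HH (Fin 1) ℝ) (hGH : GHᵀ = GH)
    (hAh : Ah = Matrix.of fun i j : ↥HH =>
      (if i = j then -(onormSq i.1.1 / (500 : ℝ)) - (6 / 25 : ℝ) else 0) + amat i.1 j.1)
    (hAHB : AHB = Matrix.of fun (i : ↥HH) (l : ↥HB) => amat i.1 l.1)
    (hABH : ABH = Matrix.of fun (l : ↥HB) (i : ↥HH) => amat l.1 i.1)
    (hE : E = fun l : ↥HB => onormSq l.1.1 / (500 : ℝ) + (6 / 25 : ℝ) - Real.sqrt 2)
    (hR1 : ∀ x : ↥HH → ℝ, x ≠ 0 →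
      x ⬝ᵥ ((GH * Ah + Ahᵀ * GH + (1 / 2 : ℝ) • ((GH * AHB + ABHᵀ) * Matrix.diagonal (fun l => (E l)⁻¹) *
        (GH * AHB + ABHᵀ)ᵀ)) *ᵥ x) < 0)
    (hR2 : ∀ x : ↥HH → ℝ, 0 ≤ x ⬝ᵥ ((GH + V * Vᵀ) *ᵥ x))
    {n : ℕ} (z : Fin n → ℂ) (hz : Function.Injective z)
    (u : Fin n → UnitAddTorus (Fin 3) → EuclideanSpace ℂ (Fin 3))
    (hu : ∀ k, Torus.LinNSResolventRel (1 / (2 * Real.pi * (500 : ℝ))) (Torus.abcFlow 1 1 1)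
      (2 * Real.pi * z k) (u k) 0)
    (hu0 : ∀ k, u k ≠ 0) (hII : ∀ k, IsClassII (mFourierCoeff (u k))) (hre : ∀ k, (6 / 25 : ℝ) ≤ (z k).re) :
    n ≤ 1 :=
  card_classII_eigenfunctions_le_of_inertia_certificate (R := 500) (a := 6 / 25) (rL := 36) (rH := 37)
    (by norm_num) (by norm_num) (by norm_num) hHL hHH hHB GH Ah AHB ABH E V hGH hAh hAHB hABH hE hR1 hR2
    R3_500_37 z hz u hu hu0 hII hre

/-! ### §3 Reading with the enclosures (R 300, class II) -/

/-- **Rightmost-ness reading, R 300 class II.** Under the cell hypotheses (either `(28, 29)` or `(28, 30)`),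
if `(λ⋆, u⋆)` is a classical class-II eigenpair with REAL eigenvalue `λ⋆ > 1/5` (the tree's `Row3002` leader:
`a_lt_leader_4`), then every classical class-II eigenpair `(z, u)` with `Re z ≥ 1/5` has `z = λ⋆`. (From the
count `≤ 1` applied to the pair `{λ⋆, z}`.) Stated abstractly from any cell conclusion `hcell`. -/
theorem eq_leader_of_card_le_one {ν : ℝ} {a : ℝ}
    (hcell : ∀ {n : ℕ} (z : Fin n → ℂ), Function.Injective z →
      ∀ (u : Fin n → UnitAddTorus (Fin 3) → EuclideanSpace ℂ (Fin 3)),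
      (∀ k, Torus.LinNSResolventRel ν (Torus.abcFlow 1 1 1) (2 * Real.pi * z k) (u k) 0) →
      (∀ k, u k ≠ 0) → (∀ k, IsClassII (mFourierCoeff (u k))) → (∀ k, a ≤ (z k).re) → n ≤ 1)
    (lam : ℂ) (ulam : UnitAddTorus (Fin 3) → EuclideanSpace ℂ (Fin 3))
    (hlam : Torus.LinNSResolventRel ν (Torus.abcFlow 1 1 1) (2 * Real.pi * lam) ulam 0) (hlam0 : ulam ≠ 0)
    (hlamII : IsClassII (mFourierCoeff ulam)) (hlamre : a ≤ lam.re)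
    (z : ℂ) (u : UnitAddTorus (Fin 3) → EuclideanSpace ℂ (Fin 3))
    (hu : Torus.LinNSResolventRel ν (Torus.abcFlow 1 1 1) (2 * Real.pi * z) u 0) (hu0 : u ≠ 0)
    (huII : IsClassII (mFourierCoeff u)) (hzre : a ≤ z.re) : z = lam := by
  by_contra hne
  have hinj : Function.Injective ![lam, z] := by
    intro i j h
    fin_cases i <;> fin_cases j
    · rfl
    · exact absurd h.symm hne
    · exact absurd h hne
    · rfl
  have h := hcell ![lam, z] hinj ![ulam, u]
    (fun k => by fin_cases k <;> assumption) (fun k => by fin_cases k <;> assumption)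
    (fun k => by fin_cases k <;> assumption) (fun k => by fin_cases k <;> assumption)
  omega

end Summit.NavierStokesRegularity.FluidComputer.AbcInertia

end
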